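import Summits.HodgeConjecture.CorCM.IrreducibleOddWeightsIsotypicRepresentatives
import Summits.HodgeConjecture.CorCM.IrreducibleOddWeightsCoveringFamily
import HarnessLib

/-!
# Isotypic cells, existence II: THE SLOT SUBSPACES OF `ℚ^{⊔_i E_i}` — extension by zero and restriction are
# equivariant mutual inverses, the slot subspaces are stable, and each is the `⨆` of an INDEPENDENT `Fin`-indexed
# family of non-zero stable irreducibles

COR-CM (cell `pub-hodgecm2`, binder seat `b16` gen 76, count-neutral claim THE ISOTYPIC DECOMPOSITION EXISTS, file
E2 — abstract `G`-set level; theorems only, no definition, no named fact, no `sorry`).  NEW as organised here, hence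
under `Summits/`.  HONEST FRAMING: bookkeeping for a finite family of finite `G`-sets `E_i` (`i ∈ I` finite) inside
the ONE permutation module `V = ℚ^{⊔_i E_i}` of the disjoint union (Mathlib's `Sigma` action), so that gen 70's
one-space theory of stable irreducibles (files I1/I2, E1) applies to the constituents of ALL slots at once; plus
complete reducibility of each slot subspace (gen 59 `exists_irreducible_decomposition`).  Nothing here mentions CM
fields; `HC_CM` is neither used nor asserted.

NOTATION (all inline, no definition): `ext_i = slotExt i : ℚ^{E_i} → V` (extension by zero, tree
`Literature/…/CMTypeRankFamilies`), `res_i = LinearMap.funLeft ℚ ℚ (Sigma.mk i) : V → ℚ^{E_i}` (restriction to the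
slot), `V_i = range ext_i` (the SLOT SUBSPACE: functions supported on `{i} × E_i`).

* §1 `funLeft_sigmaMk_slotExt` (`res_i ∘ ext_i = id`), `funLeft_sigmaMk_slotExt_of_ne` (`res_j ∘ ext_i = 0`,
  `j ≠ i`), `slotExt_funLeft_sigmaMk_of_mem_range` (`ext_i ∘ res_i = id` on `V_i`), `slotExt_translate` and
  `funLeft_sigmaMk_translate` (both maps are EQUIVARIANT for the translates `f ↦ f(k·)`), `translate_mem_range_slotExt`
  (`V_i` is STABLE), `eq_zero_of_mem_range_slotExt` (`res_i` is injective on `V_i`), `sum_slotExt_funLeft_sigmaMk`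
  (`f = Σ_i ext_i(res_i f)`), `iSup_range_slotExt_eq_top` (`⨆_i V_i = V`).
* §2 **EACH SLOT SUBSPACE IS A `⨆` OF INDEPENDENT NON-ZERO STABLE IRREDUCIBLES** (`exists_slot_decomposition`):
  there are `n` and `M : Fin n → (stable irreducible non-zero subspaces of V_i)`, INDEPENDENT, with `⨆_k M_k = V_i`
  (gen 59's decomposition with equivariant projections gives irreducibles spanning `V_i`; E1 §1 extracts an
  independent spanning sub-family of non-zero members); `exists_slot_decomposition_top` is the one-slot case
  `ℚ^{Y} = ⨆_k M_k` for any finite `G`-set `Y`.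

## References

* [Serre1977] J.-P. Serre, *Linear Representations of Finite Groups*, GTM 42, §1.3 Thm. 1, §1.4 Thm. 2 (complete
  reducibility), §2.6 (canonical decomposition).
* [Deligne1982HodgeCycles] P. Deligne, *Hodge cycles on abelian varieties*, LNM 900 (1982), I Ex. 3.7 (CM algebras:
  `S = ⊔_i Hom(K_i, ℂ)`).
* [Gordon1999HodgeAVSurvey] B. B. Gordon, *A survey of the Hodge conjecture for abelian varieties*, §3 Theorem
  (proof: `M = ⊕_i X(K_i^×)`).
-/

set_option autoImplicit false

noncomputable section

open scoped BigOperators Classical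

universe u v w

namespace Summit.HodgeConjecture.CorCM.IrrOdd

open Literature.NumberTheory.ComplexMultiplication

variable {G : Type w} [Group G] {I : Type u} {E : I → Type v} [∀ i, MulAction G (E i)]

/-! ### §1 Extension by zero, restriction, the slot subspaces -/

section SlotMaps

variable [DecidableEq I]

/-- `res_i (ext_i a) = a`: restriction after extension by zero is the identity. [cite: Gordon1999HodgeAVSurvey, §3
Theorem (proof)] -/
theorem funLeft_sigmaMk_slotExt (i : I) (a : E i → ℚ) :
    LinearMap.funLeft ℚ ℚ (Sigma.mk i) (slotExt (E := E) i a) = a := by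
  funext s
  rw [LinearMap.funLeft_apply, slotExt_apply_same]

/-- `res_j (ext_i a) = 0` for `j ≠ i`. [cite: Gordon1999HodgeAVSurvey, §3 Theorem (proof)] -/
theorem funLeft_sigmaMk_slotExt_of_ne {i j : I} (h : j ≠ i) (a : E i → ℚ) :
    LinearMap.funLeft ℚ ℚ (Sigma.mk j) (slotExt (E := E) i a) = 0 := by
  funext s
  rw [LinearMap.funLeft_apply, slotExt_apply_of_ne h, Pi.zero_apply]

/-- `ext_i (res_i f) = f` on the slot subspace `V_i = range ext_i`. [cite: Gordon1999HodgeAVSurvey, §3 Theorem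
(proof)] -/
theorem slotExt_funLeft_sigmaMk_of_mem_range (i : I) {f : (Σ i, E i) → ℚ}
    (hf : f ∈ LinearMap.range (slotExt (E := E) i)) :
    slotExt (E := E) i (LinearMap.funLeft ℚ ℚ (Sigma.mk i) f) = f := by
  obtain ⟨a, rfl⟩ := LinearMap.mem_range.1 hf
  rw [funLeft_sigmaMk_slotExt]

/-- **`ext_i` IS EQUIVARIANT**: `ext_i(a(k·)) = (ext_i a)(k·)` for the slotwise (`Sigma`) action.
[cite: Deligne1982HodgeCycles, I Ex. 3.7] -/
theorem slotExt_translate (i : I) (k : G) (a : E i → ℚ) :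
    slotExt (E := E) i (fun s => a (k • s)) = fun x => slotExt (E := E) i a (k • x) := by
  funext x
  obtain ⟨j, s⟩ := x
  rw [Sigma.smul_mk]
  by_cases hji : j = i
  · subst hji
    rw [slotExt_apply_same, slotExt_apply_same]
  · rw [slotExt_apply_of_ne hji, slotExt_apply_of_ne hji]

omit [DecidableEq I] in
/-- **`res_i` IS EQUIVARIANT**: `res_i(f(k·)) = (res_i f)(k·)`. [cite: Deligne1982HodgeCycles, I Ex. 3.7] -/
theorem funLeft_sigmaMk_translate (i : I) (k : G) (f : (Σ i, E i) → ℚ) :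
    LinearMap.funLeft ℚ ℚ (Sigma.mk i) (fun x => f (k • x)) =
      fun s => LinearMap.funLeft ℚ ℚ (Sigma.mk i) f (k • s) := by
  funext s
  rw [LinearMap.funLeft_apply, LinearMap.funLeft_apply, Sigma.smul_mk]

/-- **THE SLOT SUBSPACE `V_i = range ext_i` IS STABLE** under the translates. [cite: Deligne1982HodgeCycles, I Ex. 3.7] -/
theorem translate_mem_range_slotExt (i : I) (k : G) (f : (Σ i, E i) → ℚ)
    (hf : f ∈ LinearMap.range (slotExt (E := E) i)) :
    (fun x => f (k • x)) ∈ LinearMap.range (slotExt (E := E) i) := by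
  obtain ⟨a, rfl⟩ := LinearMap.mem_range.1 hf
  exact LinearMap.mem_range.2 ⟨fun s => a (k • s), slotExt_translate i k a⟩

/-- **`res_i` IS INJECTIVE ON `V_i`**: `f ∈ V_i`, `res_i f = 0` ⟹ `f = 0`. [cite: Gordon1999HodgeAVSurvey, §3 Theorem
(proof)] -/
theorem eq_zero_of_mem_range_slotExt (i : I) {f : (Σ i, E i) → ℚ} (hf : f ∈ LinearMap.range (slotExt (E := E) i))
    (h0 : LinearMap.funLeft ℚ ℚ (Sigma.mk i) f = 0) : f = 0 := by
  rw [← slotExt_funLeft_sigmaMk_of_mem_range i hf, h0, map_zero]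

/-- A linear map out of `ℚ^{E_i}` vanishing after `res_i` on a sum of elements of `V_i`: **`res_i (Σ_j f_j) = 0` with
all `f_j ∈ V_i` forces `Σ_j f_j = 0`** (the form used for joint independence of embeddings). [folklore] -/
theorem sum_eq_zero_of_funLeft_sigmaMk_sum_eq_zero (i : I) {J : Type*} [Fintype J] {f : J → ((Σ i, E i) → ℚ)}
    (hf : ∀ j, f j ∈ LinearMap.range (slotExt (E := E) i))
    (h0 : ∑ j, LinearMap.funLeft ℚ ℚ (Sigma.mk i) (f j) = 0) : ∑ j, f j = 0 :=
  eq_zero_of_mem_range_slotExt i (Submodule.sum_mem _ fun j _ => hf j) (by rw [map_sum, h0])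

/-- **`f = Σ_i ext_i(res_i f)`** for `I` finite: a function on the disjoint union is the sum of its slot parts.
[cite: Gordon1999HodgeAVSurvey, §3 Theorem (proof)] -/
theorem sum_slotExt_funLeft_sigmaMk [Fintype I] (f : (Σ i, E i) → ℚ) :
    ∑ i, slotExt (E := E) i (LinearMap.funLeft ℚ ℚ (Sigma.mk i) f) = f := by
  funext x
  obtain ⟨j, s⟩ := x
  rw [Finset.sum_apply, Finset.sum_eq_single j (fun i _ hij => slotExt_apply_of_ne (Ne.symm hij) _ _)
    (fun h => absurd (Finset.mem_univ j) h), slotExt_apply_same, LinearMap.funLeft_apply]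

/-- **`⨆_i V_i = V`**: the slot subspaces span `ℚ^{⊔_i E_i}` (`I` finite). [cite: Gordon1999HodgeAVSurvey, §3
Theorem (proof)] -/
theorem iSup_range_slotExt_eq_top [Fintype I] :
    (⨆ i, LinearMap.range (slotExt (E := E) i)) = ⊤ := by
  rw [eq_top_iff]
  intro f _
  rw [← sum_slotExt_funLeft_sigmaMk f]
  exact Submodule.sum_mem _ fun i _ => Submodule.mem_iSup_of_mem i (LinearMap.mem_range_self _ _)

/-- The slot subspaces are INDEPENDENT: `V_i ⊓ ⨆_{j ≠ i} V_j = 0` (restrict to the slot `i`). [folklore] -/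
theorem iSupIndep_range_slotExt [Fintype I] :
    iSupIndep fun i => LinearMap.range (slotExt (E := E) i) := by
  refine (iSupIndep_iff_finsetSum_eq_zero_imp_eq_zero _).2 fun s f hf h0 i hi => ?_
  have h1 : LinearMap.funLeft ℚ ℚ (Sigma.mk i) (∑ j ∈ s, f j) = 0 := by rw [h0, map_zero]
  rw [map_sum, Finset.sum_eq_single i (fun j hj hji => ?_) (fun h => absurd hi h)] at h1
  · exact eq_zero_of_mem_range_slotExt i (hf i hi) h1
  · obtain ⟨a, ha⟩ := LinearMap.mem_range.1 (hf j hj)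
    rw [← ha, funLeft_sigmaMk_slotExt_of_ne (Ne.symm hji)]

end SlotMaps

/-! ### §2 Each slot subspace is a `⨆` of independent non-zero stable irreducibles -/

/-- **DECOMPOSITION OF A STABLE SUBSPACE INTO INDEPENDENT NON-ZERO STABLE IRREDUCIBLES** (any finite `G`-set `Y`):
every stable `P ≤ ℚ^{Y}` is `⨆_k M_k` for an INDEPENDENT family `M : Fin n → (non-zero stable irreducible
subspaces of P)` (gen 59 `exists_irreducible_decomposition`: irreducibles `S_j ≤ P` with `Σ_j p_j = id` on `P`, so
`P = ⨆_j S_j`; E1 §1: an independent spanning sub-family of non-zero members). [cite: Serre1977, §1.3 Thm. 1 and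
§1.4 Thm. 2] -/
theorem exists_iSupIndep_irreducibles_iSup_eq {Y : Type v} [MulAction G Y] [Fintype Y] (P : Submodule ℚ (Y → ℚ))
    (hP : ∀ (k : G) (f : Y → ℚ), f ∈ P → (fun y => f (k • y)) ∈ P) :
    ∃ (n : ℕ) (M : Fin n → Submodule ℚ (Y → ℚ)),
      (∀ j, M j ≤ P) ∧
      (∀ j (k : G) (f : Y → ℚ), f ∈ M j → (fun y => f (k • y)) ∈ M j) ∧
      (∀ j, M j ≠ ⊥) ∧
      (∀ j (W : Submodule ℚ (Y → ℚ)), W ≤ M j → W ≠ ⊥ →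
        (∀ (k : G) (f : Y → ℚ), f ∈ W → (fun y => f (k • y)) ∈ W) → W = M j) ∧
      iSupIndep M ∧ (⨆ j, M j) = P := by
  obtain ⟨n, S, p, hSP, hSst, hS0, hSirr, -, hpS, hsum⟩ := exists_irreducible_decomposition (G := G) P hP
  -- `P = ⨆_j S_j`
  have hPS : (⨆ j, S j) = P := by
    refine le_antisymm (iSup_le hSP) fun f hf => ?_
    rw [← hsum f hf]
    exact Submodule.sum_mem _ fun j _ => Submodule.mem_iSup_of_mem j (hpS j f)
  -- an independent spanning sub-family of non-zero members (E1 §1), operators = translates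
  let T : G → (Y → ℚ) →ₗ[ℚ] (Y → ℚ) := fun k => LinearMap.funLeft ℚ ℚ fun y : Y => k • y
  obtain ⟨m, e, -, he0, hind, hsup⟩ := exists_fin_iSupIndep_iSup_eq T (N := S)
    (fun j k f hf => hSst j k f hf) (fun j W hW hW0 hWst => hSirr j W hW hW0 fun k f hf => hWst k f hf)
  refine ⟨m, fun k => S (e k), fun k => hSP (e k), fun k => hSst (e k), he0, fun k => hSirr (e k), hind, ?_⟩
  rw [hsup, hPS]

/-- **EACH SLOT SUBSPACE `V_i ≤ ℚ^{⊔_i E_i}` IS A `⨆` OF INDEPENDENT NON-ZERO STABLE IRREDUCIBLES**: there are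
`n` and an INDEPENDENT `M : Fin n → (non-zero stable irreducible subspaces of V_i)` with `⨆_k M_k = V_i`.
[cite: Serre1977, §1.4 Thm. 2 and §2.6] [cite: Deligne1982HodgeCycles, I Ex. 3.7] -/
theorem exists_slot_decomposition [DecidableEq I] [Fintype I] [∀ i, Fintype (E i)] (i : I) :
    ∃ (n : ℕ) (M : Fin n → Submodule ℚ ((Σ i, E i) → ℚ)),
      (∀ j, M j ≤ LinearMap.range (slotExt (E := E) i)) ∧
      (∀ j (k : G) (f : (Σ i, E i) → ℚ), f ∈ M j → (fun x => f (k • x)) ∈ M j) ∧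
      (∀ j, M j ≠ ⊥) ∧
      (∀ j (W : Submodule ℚ ((Σ i, E i) → ℚ)), W ≤ M j → W ≠ ⊥ →
        (∀ (k : G) (f : (Σ i, E i) → ℚ), f ∈ W → (fun x => f (k • x)) ∈ W) → W = M j) ∧
      iSupIndep M ∧ (⨆ j, M j) = LinearMap.range (slotExt (E := E) i) :=
  exists_iSupIndep_irreducibles_iSup_eq (G := G) _ (translate_mem_range_slotExt i)

/-- **ONE SLOT: `ℚ^{Y} = ⨆_k M_k`** for an independent family of non-zero stable irreducibles (any finite `G`-set
`Y`). [cite: Serre1977, §1.4 Thm. 2] -/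
theorem exists_slot_decomposition_top {Y : Type v} [MulAction G Y] [Fintype Y] :
    ∃ (n : ℕ) (M : Fin n → Submodule ℚ (Y → ℚ)),
      (∀ j (k : G) (f : Y → ℚ), f ∈ M j → (fun y => f (k • y)) ∈ M j) ∧
      (∀ j, M j ≠ ⊥) ∧
      (∀ j (W : Submodule ℚ (Y → ℚ)), W ≤ M j → W ≠ ⊥ →
        (∀ (k : G) (f : Y → ℚ), f ∈ W → (fun y => f (k • y)) ∈ W) → W = M j) ∧
      iSupIndep M ∧ (⨆ j, M j) = ⊤ := by
  obtain ⟨n, M, -, hMst, hM0, hMirr, hind, hsup⟩ :=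
    exists_iSupIndep_irreducibles_iSup_eq (G := G) (⊤ : Submodule ℚ (Y → ℚ)) fun _ _ _ => Submodule.mem_top
  exact ⟨n, M, hMst, hM0, hMirr, hind, hsup⟩

/-- **COMPONENTS ALONG AN INDEPENDENT DECOMPOSITION**: `w ∈ ⨆_j M_j` (`j ∈ J` finite) is `Σ_j f_j` with
`f_j ∈ M_j` (a `Fintype`-indexed form of `Submodule.mem_iSup_iff_exists_finsupp`). [folklore] -/
theorem exists_sum_eq_of_mem_iSup {W : Type*} [AddCommGroup W] [Module ℚ W] {J : Type*} [Fintype J]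
    {M : J → Submodule ℚ W} {w : W} (hw : w ∈ ⨆ j, M j) :
    ∃ f : J → W, (∀ j, f j ∈ M j) ∧ ∑ j, f j = w := by
  obtain ⟨f, hf, hfw⟩ := (Submodule.mem_iSup_iff_exists_finsupp M w).1 hw
  refine ⟨fun j => f j, hf, ?_⟩
  rw [← hfw, Finsupp.sum_fintype _ _ (fun _ => rfl)]

/-- In an INDEPENDENT family a vanishing sum of members has all terms zero (`Fintype` form of
`iSupIndep_iff_finsetSum_eq_zero_imp_eq_zero`). [folklore] -/
theorem eq_zero_of_iSupIndep_of_sum_eq_zero {W : Type*} [AddCommGroup W] [Module ℚ W] {J : Type*} [Fintype J]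
    {M : J → Submodule ℚ W} (hM : iSupIndep M) {f : J → W} (hf : ∀ j, f j ∈ M j) (h0 : ∑ j, f j = 0) :
    ∀ j, f j = 0 :=
  fun j => (iSupIndep_iff_finsetSum_eq_zero_imp_eq_zero M).1 hM Finset.univ f (fun j _ => hf j) h0 j
    (Finset.mem_univ j)

end Summit.HodgeConjecture.CorCM.IrrOdd

end
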